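/-
Copyright: cell `pub-balaban-gaps` (G2), seat ne6 (row NE7b), `prover-pub-balaban-gaps-ne6-g17-0`. Project licence.
-/
import Summits.QuantumFields.BalabanUV.T4Continuum.Spine.NE7b.CompactFibrePlaquetteMassSU2Explicit
import Literature.MathematicalPhysics.QuantumFieldTheory.Balaban1983to89.Beta.ShellValue
import Mathlib.MeasureTheory.Integral.DominatedConvergence
import Mathlib.Analysis.SpecialFunctions.Log.Basic

/-!
# THE LAPLACE LIMIT OF THE `SU(2)` ONE-PLAQUETTE MASS: `β^{3∕2}·Z_{SU(2)}(β) → (2√π)⁻¹` AS `β → ∞`, AND THE FREE-ENERGY CONSTANT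
# `−log Z_{SU(2)}(β) − (3∕2)·log β → log(2√π)` (row NE7b, node U5c; MODEL, [folklore]; census V45 — the constant behind V39∕V41's rate, EXACTLY)

Cell `pub-balaban-gaps` (G2 spine census) for the `pub-balaban` T⁴ crux NE7b (`T4WeightBudget.RelWeightBound`; NOT PRINTED, NOT PROVED).  Crux-route work under
`Spine/NE7b/`; imports the landed V41 `CompactFibrePlaquetteMassSU2Explicit` (`weylIntegrand_le_gaussian`, `explicit_le_plaquetteMass_SU2`; it re-exports V40e's
`integral_exp_neg_traceDeficit_eq`), the TREE's `…Balaban1983to89.Beta.ShellValue.integral_sq_exp_neg_sq_Ioi` (`∫₀^∞ u²e^{−u²} du = √π∕4`) + Mathlib (dominated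
convergence, `Real.sin_gt_sub_cube`, `Real.cos_bound`); no `def`, zero `sorry`, nothing of Bałaban's asserted.

THE LOCATED QUESTION.  V39 proved the RATE `−log Z_N(β) ∕ log β → (N² − 1)∕2`; V41 bracketed `Z_{SU(2)}(β)·β^{3∕2} ∈ [e⁻¹∕8, π²√π∕16] = [0.046, 1.093]`; the refuter's
instrument no. 7 (NE7bREF-G99-POST3) and no. 13 (PRICING v123 F735) report the truth `f(β) = Z(β)·β^{3∕2} ↑ 1∕(2√π) = 0.28209` («ceiling slack ×3.88»).  QUESTION (V45):
prove the limit.  ANSWER ([folklore]; `Z(β) = ∫ e^{−β·Re tr(1−U)} dHaar_{SU(2)} = (2∕π)·G(β)`, `G(β) = ∫_{(0,π)} e^{−2β(1−cos ψ)} sin²ψ dψ`):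
* §1 **`tendsto_mul_sin_sq_div_sqrt`**: `β·sin²(c∕√β) → c²` (squeeze between `c²(1 − c²∕(6β))²` and `c²`, Mathlib's `x − x³∕6 < sin x ≤ x`);
  **`tendsto_two_mul_mul_one_sub_cos_div_sqrt`**: `2β(1 − cos(u∕√β)) → u²` (`Real.cos_bound`: `|cos x − (1 − x²∕2)| ≤ (5∕96)x⁴`);
* §2 **`scaled_weylIntegral_eq_integral_Ioi`** (`β > 0`): `(√β)³·G(β) = ∫_{(0,∞)} 𝟙_{(0, π√β]}(u)·β·e^{−2β(1−cos(u∕√β))} sin²(u∕√β) du` (the substitution `ψ = u∕√β`);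
* §3 **`tendsto_scaled_weylIntegral`**: `(√β)³·G(β) → ∫_{(0,∞)} u²e^{−u²} du = √π∕4` — DOMINATED CONVERGENCE with V41's Gaussian majorant `u²e^{−(4∕π²)u²}`
  (Jordan) and the pointwise limits of §1;
* §4 (Haar currency) **`tendsto_scaled_plaquetteMass_SU2`**: `(√β)³·∫ e^{−β·Re tr(1−U)} dHaar_{SU(2)}(U) → (2√π)⁻¹` — the three Gaussian modes of `su(2)` at curvature
  read off Weyl's density; **`eventually_lt_plaquetteMass_SU2`** ∕ **`eventually_plaquetteMass_SU2_lt`**: every `C < (2√π)⁻¹` is eventually a floor and every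
  `C > (2√π)⁻¹` eventually a ceiling of `Z(β)·β^{3∕2}` — `(2√π)⁻¹` is THE constant (V41's `π²√π∕16` and `e⁻¹∕8` are not sharp; the sharp ceiling AT EVERY β,
  `Z(β) ≤ (2√π)⁻¹β^{−3∕2}`, is the junction with V44's monotonicity, filed separately);
* §5 **`tendsto_freeEnergy_constant_SU2`**: `−log Z(β) − (3∕2)·log β → log(2√π) = 1.2655…` (V39's `∃ c₁` ∕ V43's `c₁ = 1 + log 8` pinned IN THE LIMIT; the refuter's
  F722 «c₁ = 1.536 at β = 1» is this function at β = 1).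

HONEST REMARKS.  (i) MODEL ∕ [folklore]: Haar calculus of ONE `SU(2)` plaquette variable; nothing of the interacting measure.  (ii) N = 2 only (N = 3 needs the rank-2
Weyl formula — absent).  (iii) No rate of convergence is claimed (the next Laplace term `−(3∕16)β^{−1}`-type corrections are not treated); no Bessel function named.
(iv) (A3) ∕ (A1c) NOT asserted; NC-NE7b-α UNRULED.  BY-NAME EFFECT ON THE WALL: NONE.  NE7b NOT PRINTED ∕ NOT PROVED; spine PROVED 0∕9; rung (B)+1 on ONE finite T⁴ —
NOT infinite volume, NOT the mass gap, NOT Clay.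
HONEST DEPENDENCY: continuum YM on T⁴ ⇐ BetaPertH ∧ nine spine estimates (0/9 proved); BetaPertH ⇐ (D1) ∧ (D4) ∧ CAP+tail;
G-an2-4 gates asym, D1 and NE2/3/4.  This file changes none of it.
-/

set_option autoImplicit false

noncomputable section

open Real Set MeasureTheory Filter Topology
open Literature.MathematicalPhysics.QuantumFieldTheory (haarProbability)
open Summit.QuantumFields.BalabanUV.T4Continuum.NE7b.CompactFibreSU2ClassIntegral (integral_exp_neg_traceDeficit_eq)
open Summit.QuantumFields.BalabanUV.T4Continuum.NE7b.CompactFibrePlaquetteMassSU2Explicit (weylIntegrand_le_gaussian explicit_le_plaquetteMass_SU2)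

namespace Summit.QuantumFields.BalabanUV.T4Continuum.NE7b.CompactFibrePlaquetteMassSU2Limit

/-! ### §1 The two pointwise limits -/

/-- Algebra of the lower squeeze bound: `s²·(c∕s − (c∕s)³∕6)² = c²·(1 − c²∕(6s²))²` for `s ≠ 0`. -/
theorem sq_mul_sub_cube_sq_eq {s c : ℝ} (hs : s ≠ 0) :
    s ^ 2 * (c / s - (c / s) ^ 3 / 6) ^ 2 = c ^ 2 * (1 - c ^ 2 / (6 * s ^ 2)) ^ 2 := by
  field_simp

/-- **`β·sin²(c∕√β) → c²` as `β → ∞`** (`c ≥ 0`; squeeze between `c²(1 − c²∕(6β))²` and `c²`). [folklore] -/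
theorem tendsto_mul_sin_sq_div_sqrt {c : ℝ} (hc : 0 ≤ c) :
    Tendsto (fun β : ℝ => β * Real.sin (c / Real.sqrt β) ^ 2) atTop (𝓝 (c ^ 2)) := by
  have hlow : Tendsto (fun β : ℝ => c ^ 2 * (1 - c ^ 2 / (6 * β)) ^ 2) atTop (𝓝 (c ^ 2)) := by
    have h0 : Tendsto (fun β : ℝ => c ^ 2 / (6 * β)) atTop (𝓝 0) :=
      tendsto_const_nhds.div_atTop (tendsto_id.const_mul_atTop (by norm_num : (0 : ℝ) < 6))
    have h : Tendsto (fun β : ℝ => c ^ 2 * (1 - c ^ 2 / (6 * β)) ^ 2) atTop (𝓝 (c ^ 2 * (1 - 0) ^ 2)) :=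
      tendsto_const_nhds.mul ((tendsto_const_nhds.sub h0).pow 2)
    simpa using h
  refine tendsto_of_tendsto_of_tendsto_of_le_of_le' hlow tendsto_const_nhds ?_ ?_
  · filter_upwards [eventually_ge_atTop (c ^ 2), eventually_gt_atTop (0 : ℝ)] with β hβc hβ0
    have hs : 0 < Real.sqrt β := Real.sqrt_pos.2 hβ0
    have hs2 : Real.sqrt β ^ 2 = β := Real.sq_sqrt hβ0.le
    have hcs : c ≤ Real.sqrt β := Real.le_sqrt_of_sq_le hβc
    have hx0 : 0 ≤ c / Real.sqrt β := div_nonneg hc hs.le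
    have hx1 : c / Real.sqrt β ≤ 1 := (div_le_one hs).2 hcs
    -- `x − x³/6 ≤ sin x` with `0 ≤ x − x³/6`
    have hcube : (c / Real.sqrt β) ^ 3 ≤ c / Real.sqrt β := by
      have : (c / Real.sqrt β) ^ 3 ≤ (c / Real.sqrt β) ^ 1 := pow_le_pow_of_le_one hx0 hx1 (by norm_num)
      simpa using this
    have hl0 : 0 ≤ c / Real.sqrt β - (c / Real.sqrt β) ^ 3 / 6 := by linarith
    have hsin : c / Real.sqrt β - (c / Real.sqrt β) ^ 3 / 6 ≤ Real.sin (c / Real.sqrt β) := by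
      rcases hx0.eq_or_lt with h | h
      · rw [← h]; simp
      · exact (Real.sin_gt_sub_cube h).le
    have hsq : (c / Real.sqrt β - (c / Real.sqrt β) ^ 3 / 6) ^ 2 ≤ Real.sin (c / Real.sqrt β) ^ 2 := pow_le_pow_left₀ hl0 hsin 2
    calc c ^ 2 * (1 - c ^ 2 / (6 * β)) ^ 2 = Real.sqrt β ^ 2 * (c / Real.sqrt β - (c / Real.sqrt β) ^ 3 / 6) ^ 2 := by
          rw [sq_mul_sub_cube_sq_eq hs.ne', hs2]
      _ ≤ Real.sqrt β ^ 2 * Real.sin (c / Real.sqrt β) ^ 2 := mul_le_mul_of_nonneg_left hsq (sq_nonneg _)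
      _ = β * Real.sin (c / Real.sqrt β) ^ 2 := by rw [hs2]
  · filter_upwards [eventually_ge_atTop (c ^ 2), eventually_gt_atTop (0 : ℝ)] with β hβc hβ0
    have hs : 0 < Real.sqrt β := Real.sqrt_pos.2 hβ0
    have hs2 : Real.sqrt β ^ 2 = β := Real.sq_sqrt hβ0.le
    have hcs : c ≤ Real.sqrt β := Real.le_sqrt_of_sq_le hβc
    have hx0 : 0 ≤ c / Real.sqrt β := div_nonneg hc hs.le
    have hx1 : c / Real.sqrt β ≤ 1 := (div_le_one hs).2 hcs
    have hsin0 : 0 ≤ Real.sin (c / Real.sqrt β) :=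
      Real.sin_nonneg_of_nonneg_of_le_pi hx0 (hx1.trans (by linarith [Real.pi_gt_three]))
    have hsq : Real.sin (c / Real.sqrt β) ^ 2 ≤ (c / Real.sqrt β) ^ 2 := pow_le_pow_left₀ hsin0 (Real.sin_le hx0) 2
    calc β * Real.sin (c / Real.sqrt β) ^ 2 ≤ β * (c / Real.sqrt β) ^ 2 := mul_le_mul_of_nonneg_left hsq hβ0.le
      _ = c ^ 2 := by rw [div_pow, hs2]; field_simp

/-- **`2β·(1 − cos(u∕√β)) → u²` as `β → ∞`** (squeeze: `|cos x − (1 − x²∕2)| ≤ (5∕96)x⁴` for `|x| ≤ 1`, so the distance to `u²` is at most `(5∕48)·u⁴∕β`). [folklore] -/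
theorem tendsto_two_mul_mul_one_sub_cos_div_sqrt (u : ℝ) :
    Tendsto (fun β : ℝ => 2 * β * (1 - Real.cos (u / Real.sqrt β))) atTop (𝓝 (u ^ 2)) := by
  have herr : Tendsto (fun β : ℝ => 5 / 48 * u ^ 4 / β) atTop (𝓝 0) := tendsto_const_nhds.div_atTop tendsto_id
  have hlow : Tendsto (fun β : ℝ => u ^ 2 - 5 / 48 * u ^ 4 / β) atTop (𝓝 (u ^ 2)) := by simpa using tendsto_const_nhds.sub herr
  have hup : Tendsto (fun β : ℝ => u ^ 2 + 5 / 48 * u ^ 4 / β) atTop (𝓝 (u ^ 2)) := by simpa using tendsto_const_nhds.add herr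
  have key : ∀ β : ℝ, u ^ 2 ≤ β → 0 < β → |2 * β * (1 - Real.cos (u / Real.sqrt β)) - u ^ 2| ≤ 5 / 48 * u ^ 4 / β := fun β hβu hβ0 => by
    have hs : 0 < Real.sqrt β := Real.sqrt_pos.2 hβ0
    have hs2 : Real.sqrt β ^ 2 = β := Real.sq_sqrt hβ0.le
    have hx2 : (u / Real.sqrt β) ^ 2 = u ^ 2 / β := by rw [div_pow, hs2]
    have hx1 : |u / Real.sqrt β| ≤ 1 := by
      rw [abs_le_one_iff_mul_self_le_one, ← sq, hx2, div_le_one hβ0]; exact hβu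
    have hb := Real.cos_bound hx1
    have hx4 : |u / Real.sqrt β| ^ 4 = u ^ 4 / β ^ 2 := by
      rw [show (4 : ℕ) = 2 * 2 from rfl, pow_mul, sq_abs, hx2, div_pow]; ring
    rw [hx4] at hb
    have e : 2 * β * (1 - Real.cos (u / Real.sqrt β)) - u ^ 2 = -(2 * β) * (Real.cos (u / Real.sqrt β) - (1 - (u / Real.sqrt β) ^ 2 / 2)) := by
      rw [hx2]; field_simp; ring
    rw [e, abs_mul, abs_neg, abs_of_pos (by linarith : (0 : ℝ) < 2 * β)]
    calc 2 * β * |Real.cos (u / Real.sqrt β) - (1 - (u / Real.sqrt β) ^ 2 / 2)| ≤ 2 * β * (u ^ 4 / β ^ 2 * (5 / 96)) :=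
          mul_le_mul_of_nonneg_left hb (by linarith)
      _ = 5 / 48 * u ^ 4 / β := by field_simp; ring
  refine tendsto_of_tendsto_of_tendsto_of_le_of_le' hlow hup ?_ ?_
  · filter_upwards [eventually_ge_atTop (u ^ 2), eventually_gt_atTop (0 : ℝ)] with β hβu hβ0
    have := (abs_le.1 (key β hβu hβ0)).1
    linarith
  · filter_upwards [eventually_ge_atTop (u ^ 2), eventually_gt_atTop (0 : ℝ)] with β hβu hβ0
    have := (abs_le.1 (key β hβu hβ0)).2
    linarith

/-- **The pointwise limit of the rescaled integrand**: for every real `u`,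
`β·(e^{−2β(1−cos(u∕√β))}·sin²(u∕√β)) → u²·e^{−u²}`. [folklore] -/
theorem tendsto_rescaled_integrand {u : ℝ} (hu : 0 ≤ u) :
    Tendsto (fun β : ℝ => β * (Real.exp (-(2 * β * (1 - Real.cos (u / Real.sqrt β)))) * Real.sin (u / Real.sqrt β) ^ 2)) atTop
      (𝓝 (u ^ 2 * Real.exp (-u ^ 2))) := by
  have h1 := tendsto_mul_sin_sq_div_sqrt hu
  have h2 : Tendsto (fun β : ℝ => Real.exp (-(2 * β * (1 - Real.cos (u / Real.sqrt β))))) atTop (𝓝 (Real.exp (-u ^ 2))) :=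
    (Real.continuous_exp.tendsto _).comp (tendsto_two_mul_mul_one_sub_cos_div_sqrt u).neg
  have h := h1.mul h2
  refine (h.congr fun β => by ring).congr' (Filter.Eventually.of_forall fun β => rfl) |>.trans ?_
  rw [mul_comm]

/-! ### §2 The substitution `ψ = u∕√β` -/

/-- **`(√β)³·G(β)` AS AN INTEGRAL OVER `(0, ∞)`**: for `β > 0`,
`(√β)³·∫_{(0,π)} e^{−2β(1−cos ψ)} sin²ψ dψ = ∫_{(0,∞)} 𝟙_{(0,π√β]}(u)·β·e^{−2β(1−cos(u∕√β))}·sin²(u∕√β) du`. [folklore] -/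
theorem scaled_weylIntegral_eq_integral_Ioi {β : ℝ} (hβ : 0 < β) :
    Real.sqrt β ^ 3 * ∫ ψ in Set.Ioo 0 Real.pi, Real.exp (-(2 * β * (1 - Real.cos ψ))) * Real.sin ψ ^ 2
      = ∫ u in Set.Ioi (0 : ℝ), (Set.Ioc 0 (Real.pi * Real.sqrt β)).indicator
          (fun u => β * (Real.exp (-(2 * β * (1 - Real.cos (u / Real.sqrt β)))) * Real.sin (u / Real.sqrt β) ^ 2)) u := by
  have hπ := Real.pi_pos
  have hs : 0 < Real.sqrt β := Real.sqrt_pos.2 hβ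
  have hs2 : Real.sqrt β ^ 2 = β := Real.sq_sqrt hβ.le
  -- the substitution on interval integrals
  have hsub := intervalIntegral.integral_comp_div (a := 0) (b := Real.pi * Real.sqrt β)
    (fun ψ : ℝ => Real.exp (-(2 * β * (1 - Real.cos ψ))) * Real.sin ψ ^ 2) hs.ne'
  rw [zero_div, mul_div_cancel_right₀ _ hs.ne', smul_eq_mul] at hsub
  -- `∫_{(0,π)} g = (√β)⁻¹·∫₀^{π√β} g(u/√β) du`
  have hG : ∫ ψ in Set.Ioo 0 Real.pi, Real.exp (-(2 * β * (1 - Real.cos ψ))) * Real.sin ψ ^ 2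
      = (Real.sqrt β)⁻¹ * ∫ u in (0 : ℝ)..Real.pi * Real.sqrt β, Real.exp (-(2 * β * (1 - Real.cos (u / Real.sqrt β)))) * Real.sin (u / Real.sqrt β) ^ 2 := by
    rw [hsub, ← mul_assoc, inv_mul_cancel₀ hs.ne', one_mul, intervalIntegral.integral_of_le hπ.le, integral_Ioc_eq_integral_Ioo]
  rw [hG, setIntegral_indicator measurableSet_Ioc, Set.inter_eq_right.2 Set.Ioc_subset_Ioi_self,
    ← intervalIntegral.integral_of_le (by positivity), intervalIntegral.integral_const_mul, ← mul_assoc]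
  congr 1
  rw [pow_succ, hs2, mul_assoc, mul_inv_cancel₀ hs.ne', mul_one]

/-! ### §3 Dominated convergence -/

/-- **THE LAPLACE LIMIT IN WEYL's VARIABLE**: `(√β)³·∫_{(0,π)} e^{−2β(1−cos ψ)} sin²ψ dψ → √π∕4` as `β → ∞` (dominated convergence after `ψ = u∕√β`, majorant
`u²e^{−(4∕π²)u²}` from V41's `weylIntegrand_le_gaussian`). [folklore] -/
theorem tendsto_scaled_weylIntegral :
    Tendsto (fun β : ℝ => Real.sqrt β ^ 3 * ∫ ψ in Set.Ioo 0 Real.pi, Real.exp (-(2 * β * (1 - Real.cos ψ))) * Real.sin ψ ^ 2) atTop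
      (𝓝 (Real.sqrt Real.pi / 4)) := by
  have hπ := Real.pi_pos
  -- the rescaled, truncated integrands
  set F : ℝ → ℝ → ℝ := fun β u => (Set.Ioc 0 (Real.pi * Real.sqrt β)).indicator
    (fun u => β * (Real.exp (-(2 * β * (1 - Real.cos (u / Real.sqrt β)))) * Real.sin (u / Real.sqrt β) ^ 2)) u with hF
  have hcont : ∀ β : ℝ, Continuous fun u : ℝ => β * (Real.exp (-(2 * β * (1 - Real.cos (u / Real.sqrt β)))) * Real.sin (u / Real.sqrt β) ^ 2) :=
    fun β => by fun_prop
  have hF_meas : ∀ᶠ β in atTop, AEStronglyMeasurable (F β) (volume.restrict (Set.Ioi (0 : ℝ))) :=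
    Filter.Eventually.of_forall fun β => ((hcont β).aestronglyMeasurable).indicator measurableSet_Ioc
  -- domination by the Gaussian majorant
  have h_bound : ∀ᶠ β in atTop, ∀ᵐ u ∂(volume.restrict (Set.Ioi (0 : ℝ))), ‖F β u‖ ≤ u ^ 2 * Real.exp (-(4 / Real.pi ^ 2) * u ^ 2) := by
    filter_upwards [eventually_gt_atTop (0 : ℝ)] with β hβ
    refine ae_of_all _ fun u => ?_
    have hs : 0 < Real.sqrt β := Real.sqrt_pos.2 hβ
    have hs2 : Real.sqrt β ^ 2 = β := Real.sq_sqrt hβ.le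
    by_cases hu : u ∈ Set.Ioc 0 (Real.pi * Real.sqrt β)
    · have hψ0 : 0 ≤ u / Real.sqrt β := div_nonneg hu.1.le hs.le
      have hψπ : u / Real.sqrt β ≤ Real.pi := (div_le_iff₀ hs).2 hu.2
      have hw := weylIntegrand_le_gaussian hβ.le hψ0 hψπ
      have hx2 : (u / Real.sqrt β) ^ 2 = u ^ 2 / β := by rw [div_pow, hs2]
      rw [hx2] at hw
      simp only [hF, Set.indicator_of_mem hu, Real.norm_eq_abs]
      rw [abs_of_nonneg (mul_nonneg hβ.le (mul_nonneg (Real.exp_pos _).le (sq_nonneg _)))]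
      calc β * (Real.exp (-(2 * β * (1 - Real.cos (u / Real.sqrt β)))) * Real.sin (u / Real.sqrt β) ^ 2)
          ≤ β * (u ^ 2 / β * Real.exp (-(4 * β / Real.pi ^ 2) * (u ^ 2 / β))) := mul_le_mul_of_nonneg_left hw hβ.le
        _ = u ^ 2 * Real.exp (-(4 / Real.pi ^ 2) * u ^ 2) := by
          rw [← mul_assoc, mul_div_cancel₀ _ hβ.ne']
          congr 2
          field_simp
    · simp only [hF, Set.indicator_of_notMem hu, norm_zero]
      positivity
  have hint : Integrable (fun u : ℝ => u ^ 2 * Real.exp (-(4 / Real.pi ^ 2) * u ^ 2)) (volume.restrict (Set.Ioi (0 : ℝ))) := by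
    have h := integrable_rpow_mul_exp_neg_mul_sq (by positivity : (0 : ℝ) < 4 / Real.pi ^ 2) (s := 2) (by norm_num)
    simp only [Real.rpow_two] at h
    exact h.restrict
  -- pointwise limits on `(0, ∞)`
  have h_lim : ∀ᵐ u ∂(volume.restrict (Set.Ioi (0 : ℝ))), Tendsto (fun β => F β u) atTop (𝓝 (u ^ 2 * Real.exp (-u ^ 2))) := by
    refine ae_restrict_of_forall_mem measurableSet_Ioi fun u hu => ?_
    have hu0 : 0 < u := hu
    refine (tendsto_rescaled_integrand hu0.le).congr' ?_
    filter_upwards [eventually_ge_atTop ((u / Real.pi) ^ 2), eventually_gt_atTop (0 : ℝ)] with β hβu hβ0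
    have hmem : u ∈ Set.Ioc 0 (Real.pi * Real.sqrt β) := by
      refine ⟨hu0, ?_⟩
      have := Real.le_sqrt_of_sq_le hβu
      rwa [div_le_iff₀' hπ] at this
    simp only [hF, Set.indicator_of_mem hmem]
  have hDCT := tendsto_integral_filter_of_dominated_convergence (fun u : ℝ => u ^ 2 * Real.exp (-(4 / Real.pi ^ 2) * u ^ 2)) hF_meas h_bound hint h_lim
  rw [Literature.MathematicalPhysics.QuantumFieldTheory.Balaban1983to89.Beta.ShellValue.integral_sq_exp_neg_sq_Ioi] at hDCT
  refine hDCT.congr' ?_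
  filter_upwards [eventually_gt_atTop (0 : ℝ)] with β hβ
  simp only [hF]
  exact (scaled_weylIntegral_eq_integral_Ioi hβ).symm

/-! ### §4 Haar currency -/

/-- `(2∕π)·(√π∕4) = (2√π)⁻¹`. -/
theorem two_div_pi_mul_sqrt_pi_div_four : 2 / Real.pi * (Real.sqrt Real.pi / 4) = (2 * Real.sqrt Real.pi)⁻¹ := by
  have hπ := Real.pi_pos
  have hs : 0 < Real.sqrt Real.pi := Real.sqrt_pos.2 hπ
  have hss : Real.sqrt Real.pi * Real.sqrt Real.pi = Real.pi := Real.mul_self_sqrt hπ.le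
  field_simp
  nlinarith [hss]

/-- **THE LAPLACE LIMIT OF THE `SU(2)` ONE-PLAQUETTE MASS**: `(√β)³·∫ e^{−β·Re tr(1−U)} dHaar_{SU(2)}(U) → (2√π)⁻¹ = 0.28209…` as `β → ∞`
(three Gaussian modes: `lim = (2∕π)·∫₀^∞ u²e^{−u²} du`). [folklore] -/
theorem tendsto_scaled_plaquetteMass_SU2 :
    Tendsto (fun β : ℝ => Real.sqrt β ^ 3 *
        ∫ U, Real.exp (-(β * (Matrix.trace (1 - (U : Matrix (Fin 2) (Fin 2) ℂ))).re)) ∂(haarProbability (Matrix.specialUnitaryGroup (Fin 2) ℂ)))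
      atTop (𝓝 ((2 * Real.sqrt Real.pi)⁻¹)) := by
  have h := tendsto_scaled_weylIntegral.const_mul (2 / Real.pi)
  rw [two_div_pi_mul_sqrt_pi_div_four] at h
  refine h.congr' ?_
  filter_upwards [eventually_ge_atTop (0 : ℝ)] with β hβ
  rw [integral_exp_neg_traceDeficit_eq hβ]
  ring

/-- **EVERY `C < (2√π)⁻¹` IS EVENTUALLY A FLOOR**: `C·((√β)⁻¹)³ < Z(β)` for all large `β`. [folklore] -/
theorem eventually_lt_plaquetteMass_SU2 {C : ℝ} (hC : C < (2 * Real.sqrt Real.pi)⁻¹) :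
    ∀ᶠ β : ℝ in atTop, C * ((Real.sqrt β)⁻¹) ^ 3
      < ∫ U, Real.exp (-(β * (Matrix.trace (1 - (U : Matrix (Fin 2) (Fin 2) ℂ))).re)) ∂(haarProbability (Matrix.specialUnitaryGroup (Fin 2) ℂ)) := by
  filter_upwards [tendsto_scaled_plaquetteMass_SU2.eventually_const_lt hC, eventually_gt_atTop (0 : ℝ)] with β hβ hβ0
  have hs : 0 < Real.sqrt β := Real.sqrt_pos.2 hβ0
  rw [inv_pow, ← div_eq_mul_inv, div_lt_iff₀ (pow_pos hs 3)]
  linarith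

/-- **EVERY `C > (2√π)⁻¹` IS EVENTUALLY A CEILING**: `Z(β) < C·((√β)⁻¹)³` for all large `β` — so `(2√π)⁻¹` is THE constant of the `β^{−3∕2}` law
(V41's ceiling `π²√π∕16 = 1.0933` and floor `e⁻¹∕8 = 0.0460` are not sharp). [folklore] -/
theorem eventually_plaquetteMass_SU2_lt {C : ℝ} (hC : (2 * Real.sqrt Real.pi)⁻¹ < C) :
    ∀ᶠ β : ℝ in atTop,
      ∫ U, Real.exp (-(β * (Matrix.trace (1 - (U : Matrix (Fin 2) (Fin 2) ℂ))).re)) ∂(haarProbability (Matrix.specialUnitaryGroup (Fin 2) ℂ))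
        < C * ((Real.sqrt β)⁻¹) ^ 3 := by
  filter_upwards [tendsto_scaled_plaquetteMass_SU2.eventually_lt_const hC, eventually_gt_atTop (0 : ℝ)] with β hβ hβ0
  have hs : 0 < Real.sqrt β := Real.sqrt_pos.2 hβ0
  rw [inv_pow, ← div_eq_mul_inv, lt_div_iff₀ (pow_pos hs 3)]
  linarith

/-! ### §5 The free-energy constant -/

/-- **THE FREE-ENERGY CONSTANT**: `−log ∫ e^{−β·Re tr(1−U)} dHaar_{SU(2)}(U) − (3∕2)·log β → log(2√π) = 1.2655…` as `β → ∞`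
(V39's `|−log Z − ((N²−1)∕2)·log β| ≤ c₁` with the constant IDENTIFIED in the limit for N = 2). [folklore] -/
theorem tendsto_freeEnergy_constant_SU2 :
    Tendsto (fun β : ℝ =>
        -Real.log (∫ U, Real.exp (-(β * (Matrix.trace (1 - (U : Matrix (Fin 2) (Fin 2) ℂ))).re)) ∂(haarProbability (Matrix.specialUnitaryGroup (Fin 2) ℂ)))
          - 3 / 2 * Real.log β)
      atTop (𝓝 (Real.log (2 * Real.sqrt Real.pi))) := by
  have hπ := Real.pi_pos
  have hL : 0 < (2 * Real.sqrt Real.pi)⁻¹ := by positivity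
  have hlog := (Real.continuousAt_log hL.ne').tendsto.comp tendsto_scaled_plaquetteMass_SU2
  rw [Real.log_inv] at hlog
  have hneg := hlog.neg
  rw [neg_neg] at hneg
  refine hneg.congr' ?_
  filter_upwards [eventually_ge_atTop (1 / 4 : ℝ)] with β hβ
  have hβ0 : 0 < β := by linarith
  have hs : 0 < Real.sqrt β := Real.sqrt_pos.2 hβ0
  have hZ : 0 < ∫ U, Real.exp (-(β * (Matrix.trace (1 - (U : Matrix (Fin 2) (Fin 2) ℂ))).re)) ∂(haarProbability (Matrix.specialUnitaryGroup (Fin 2) ℂ)) :=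
    lt_of_lt_of_le (by positivity) (explicit_le_plaquetteMass_SU2 hβ)
  simp only [Function.comp]
  rw [Real.log_mul (pow_pos hs 3).ne' hZ.ne', Real.log_pow, Real.log_sqrt hβ0.le]
  push_cast
  ring

end Summit.QuantumFields.BalabanUV.T4Continuum.NE7b.CompactFibrePlaquetteMassSU2Limit

end
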